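import Literature.Analysis.FluidPDE.PlanarChainChecks
import Mathlib.Analysis.SpecialFunctions.Integrals.Basic
import HarnessLib

/-!
# Clock-affine piecewise profiles with rational data (the profile algebra of a typed chain)

Topic `Literature/Analysis/FluidPDE`. Helper file of the explicit pullback calculus for the planar
transport equation (`PlanarPullbackKinematics.lean` and its sequels). Every one-dimensional datum of
an element of a design — the displacement profile `T(t,·)` of a graph band, its material
reparametrisation `Ξ(t,·)` — is a **piecewise profile**

  `F(α, u) = c(α) + s(α) u + Σᵢ Jᵢ(α) · rampAt (bᵢ(α)) ℓᵢ u`,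

where the value offset `c`, the base slope `s`, the slope jumps `Jᵢ` and the breakpoints `bᵢ` are
AFFINE in one clock value `α ∈ [0,1]` with RATIONAL endpoint data (`Aff`), and the transition
lengths `ℓᵢ` are positive rationals (`Kink`, `Pw`). This file provides

* the second antiderivative of the smooth step, `stepRamp2 x = ∫₀ˣ stepRamp` (`= 0` on
  `(-∞, 1/3]`, `= (x - 1/2)²/2 + K₂` EXACTLY on `[2/3, ∞)` with one universal constant `K₂`),
  and `ramp2At a ρ` (an antiderivative of `rampAt a ρ`), with the derivatives of `rampAt`,
  `ramp2At` in the breakpoint;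
* the rational affine data `Aff` (`eval`, `rate`, arithmetic, order from the two endpoints);
* for a profile `F : Pw`: the value `F.val α u`, the partial derivatives `F.du`, `F.dα`, `F.duu`,
  `F.dαu` and an antiderivative `F.dαPrim` of `F.dα` in `u` (all explicit), the corresponding
  `HasDerivAt` statements in `u` and in `α`, joint smoothness in `(α, u)`, the EXACT closed forms
  on the gaps between transitions (`val_eq_gapVal`, `du_eq_W`, …), and two-sided bounds for the
  slope `F.du` from the gap slopes `F.W m` for separated kinks (`le_du_of_le_W`, `du_le_of_W_le`) —
  the positivity `Ξᵤ > 0` of a material map is thereby a finite rational check.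

Folklore (calculus of smooth steps); no named facts. Infrastructure towards a discharge of
`acm_compatible_blocks` (`QuasiSelfSimilarCompatibleBlocks.lean`): the typed-chain data model of
the Level-4 emitter is built on `Pw`.

## References

* G. Alberti, G. Crippa, A. L. Mazzucato, *Exponential self-similar mixing by incompressible
  flows*, J. Amer. Math. Soc. 32 (2019), 445–490, §§7–8 (arXiv:1605.02090).
-/

open Set Filter Topology MeasureTheory intervalIntegral
open scoped ContDiff

noncomputable section

namespace Literature.Analysis.FluidPDE

namespace PlanarKinematics

open Gluing

/-! ## The second antiderivative of the step -/

/-- **Second antiderivative of the step**: `stepRamp2 x = ∫₀ˣ stepRamp`. [folklore] -/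
def stepRamp2 (x : ℝ) : ℝ := ∫ s in (0 : ℝ)..x, stepRamp s

/-- Unfolding. [folklore] -/
theorem stepRamp2_def (x : ℝ) : stepRamp2 x = ∫ s in (0 : ℝ)..x, stepRamp s := rfl

/-- The ramp is interval integrable. [folklore] -/
theorem stepRamp_intervalIntegrable (a b : ℝ) : IntervalIntegrable stepRamp volume a b :=
  stepRamp_continuous.intervalIntegrable a b

/-- `stepRamp2' = stepRamp`. [folklore] -/
theorem hasDerivAt_stepRamp2 (x : ℝ) : HasDerivAt stepRamp2 (stepRamp x) x :=
  (stepRamp_continuous.integral_hasStrictDerivAt 0 x).hasDerivAt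

/-- The derivative of `stepRamp2`. [folklore] -/
theorem deriv_stepRamp2 : deriv stepRamp2 = stepRamp := funext fun x => (hasDerivAt_stepRamp2 x).deriv

/-- `stepRamp2` is differentiable. [folklore] -/
theorem stepRamp2_differentiable : Differentiable ℝ stepRamp2 := fun x => (hasDerivAt_stepRamp2 x).differentiableAt

/-- `stepRamp2` is smooth. [folklore] -/
theorem stepRamp2_contDiff {n : ℕ∞} : ContDiff ℝ n stepRamp2 := by
  have h : ContDiff ℝ ((n : WithTop ℕ∞) + 1) stepRamp2 := by
    rw [contDiff_succ_iff_deriv]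
    refine ⟨stepRamp2_differentiable, fun hω => ?_, ?_⟩
    · exact absurd hω (by simp)
    · rw [deriv_stepRamp2]; exact stepRamp_contDiff
  exact h.of_le le_self_add

/-- `stepRamp2` is continuous. [folklore] -/
theorem stepRamp2_continuous : Continuous stepRamp2 := stepRamp2_differentiable.continuous

/-- `stepRamp2` vanishes on `(-∞, 1/3]`. [folklore] -/
theorem stepRamp2_of_le {x : ℝ} (hx : x ≤ 1 / 3) : stepRamp2 x = 0 := by
  rw [stepRamp2_def]
  have h : ∀ s ∈ uIcc (0 : ℝ) x, stepRamp s = 0 := by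
    intro s hs
    rw [mem_uIcc] at hs
    apply stepRamp_of_le
    rcases hs with ⟨_, h2⟩ | ⟨_, h2⟩ <;> linarith
  rw [integral_congr (g := fun _ => (0 : ℝ)) h, intervalIntegral.integral_zero]

/-- **The universal transition constant** of the second antiderivative:
`K₂ = stepRamp2 (2/3) - 1/72`. [folklore] -/
def K₂ : ℝ := stepRamp2 (2 / 3) - 1 / 72

/-- **`stepRamp2` is exactly quadratic on `[2/3, ∞)`**: `stepRamp2 x = (x - 1/2)²/2 + K₂`.
[folklore] -/
theorem stepRamp2_of_ge {x : ℝ} (hx : 2 / 3 ≤ x) : stepRamp2 x = (x - 1 / 2) ^ 2 / 2 + K₂ := by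
  have hsplit : stepRamp2 x = stepRamp2 (2 / 3) + ∫ s in (2 / 3 : ℝ)..x, stepRamp s := by
    rw [stepRamp2_def, stepRamp2_def]
    exact (integral_add_adjacent_intervals (stepRamp_intervalIntegrable _ _)
      (stepRamp_intervalIntegrable _ _)).symm
  have h3 : ∫ s in (2 / 3 : ℝ)..x, stepRamp s = ∫ s in (2 / 3 : ℝ)..x, (s - 1 / 2) := by
    refine integral_congr fun s hs => ?_
    rw [uIcc_of_le hx, mem_Icc] at hs
    exact stepRamp_of_ge hs.1
  have h4 : ∫ s in (2 / 3 : ℝ)..x, (s - 1 / 2) = (x ^ 2 - (2 / 3) ^ 2) / 2 - (x - 2 / 3) * (1 / 2) := by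
    rw [intervalIntegral.integral_sub intervalIntegral.intervalIntegrable_id intervalIntegrable_const, integral_id,
      intervalIntegral.integral_const, smul_eq_mul]
  rw [hsplit, h3, h4, K₂]
  ring

/-- **Second ramp at `a` with transition length `ρ`**: `ramp2At a ρ x = ρ² · stepRamp2 ((x - a)/ρ)`,
an antiderivative of `rampAt a ρ`. [folklore] -/
def ramp2At (a ρ : ℝ) (x : ℝ) : ℝ := ρ ^ 2 * stepRamp2 ((x - a) / ρ)

/-- Unfolding. [folklore] -/
theorem ramp2At_apply (a ρ x : ℝ) : ramp2At a ρ x = ρ ^ 2 * stepRamp2 ((x - a) / ρ) := rfl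

/-- `ramp2At` vanishes before the transition. [folklore] -/
theorem ramp2At_of_le {a ρ x : ℝ} (hρ : 0 < ρ) (hx : x ≤ a + ρ / 3) : ramp2At a ρ x = 0 := by
  rw [ramp2At_apply, stepRamp2_of_le, mul_zero]
  rw [div_le_iff₀ hρ]; linarith

/-- **`ramp2At` is exactly quadratic after the transition**:
`ramp2At a ρ x = (x - a - ρ/2)²/2 + ρ² K₂` for `x ≥ a + 2ρ/3`. [folklore] -/
theorem ramp2At_of_ge {a ρ x : ℝ} (hρ : 0 < ρ) (hx : a + 2 * ρ / 3 ≤ x) :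
    ramp2At a ρ x = (x - a - ρ / 2) ^ 2 / 2 + ρ ^ 2 * K₂ := by
  rw [ramp2At_apply, stepRamp2_of_ge]
  · have e : (x - a) / ρ - 1 / 2 = (x - a - ρ / 2) / ρ := by field_simp
    rw [e]
    field_simp
  · rw [le_div_iff₀ hρ]; linarith

/-- The derivative of `ramp2At a ρ` is `rampAt a ρ`. [folklore] -/
theorem hasDerivAt_ramp2At {a ρ : ℝ} (hρ : ρ ≠ 0) (x : ℝ) : HasDerivAt (ramp2At a ρ) (rampAt a ρ x) x := by
  have h1 : HasDerivAt (fun y => (y - a) / ρ) (1 / ρ) x := by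
    simpa using ((hasDerivAt_id x).sub_const a).div_const ρ
  have h2 : HasDerivAt (fun y => stepRamp2 ((y - a) / ρ)) (stepRamp ((x - a) / ρ) * (1 / ρ)) x :=
    (hasDerivAt_stepRamp2 _).comp x h1
  have h3 := h2.const_mul (ρ ^ 2)
  have e : ρ ^ 2 * (stepRamp ((x - a) / ρ) * (1 / ρ)) = rampAt a ρ x := by
    rw [rampAt_apply]; field_simp
  rw [e] at h3
  exact h3

/-- `ramp2At a ρ` is smooth. [folklore] -/
theorem ramp2At_contDiff {a ρ : ℝ} {n : ℕ∞} : ContDiff ℝ n (ramp2At a ρ) :=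
  contDiff_const.mul (stepRamp2_contDiff.comp ((contDiff_id.sub contDiff_const).div_const ρ))

/-! ## Derivatives in the breakpoint and joint smoothness -/

/-- The derivative of `a ↦ step ((x - a)/ρ)`. [folklore] -/
theorem hasDerivAt_step_breakpoint (ρ x a : ℝ) :
    HasDerivAt (fun a' => step ((x - a') / ρ)) (-(deriv step ((x - a) / ρ) / ρ)) a := by
  have h1 : HasDerivAt (fun a' => (x - a') / ρ) (-1 / ρ) a := by
    simpa using ((hasDerivAt_const a x).sub (hasDerivAt_id a)).div_const ρ
  have h2 : HasDerivAt step (deriv step ((x - a) / ρ)) ((x - a) / ρ) :=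
    (step_contDiff (n := 1)).differentiable one_ne_zero _ |>.hasDerivAt
  have h := h2.comp a h1
  refine h.congr_deriv ?_
  ring

/-- **The derivative of `rampAt a ρ x` in the breakpoint `a`** is `-step ((x - a)/ρ)`. [folklore] -/
theorem hasDerivAt_rampAt_breakpoint {ρ : ℝ} (hρ : ρ ≠ 0) (x a : ℝ) :
    HasDerivAt (fun a' => rampAt a' ρ x) (-step ((x - a) / ρ)) a := by
  have h1 : HasDerivAt (fun a' => (x - a') / ρ) (-1 / ρ) a := by
    simpa using ((hasDerivAt_const a x).sub (hasDerivAt_id a)).div_const ρ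
  have h2 : HasDerivAt (fun a' => stepRamp ((x - a') / ρ)) (step ((x - a) / ρ) * (-1 / ρ)) a :=
    (hasDerivAt_stepRamp _).comp a h1
  have h3 := h2.const_mul ρ
  have e : ρ * (step ((x - a) / ρ) * (-1 / ρ)) = -step ((x - a) / ρ) := by field_simp
  rw [e] at h3
  exact h3

/-- **The derivative of `ramp2At a ρ x` in the breakpoint `a`** is `-rampAt a ρ x`. [folklore] -/
theorem hasDerivAt_ramp2At_breakpoint {ρ : ℝ} (hρ : ρ ≠ 0) (x a : ℝ) :
    HasDerivAt (fun a' => ramp2At a' ρ x) (-rampAt a ρ x) a := by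
  have h1 : HasDerivAt (fun a' => (x - a') / ρ) (-1 / ρ) a := by
    simpa using ((hasDerivAt_const a x).sub (hasDerivAt_id a)).div_const ρ
  have h2 : HasDerivAt (fun a' => stepRamp2 ((x - a') / ρ)) (stepRamp ((x - a) / ρ) * (-1 / ρ)) a :=
    (hasDerivAt_stepRamp2 _).comp a h1
  have h3 := h2.const_mul (ρ ^ 2)
  have e : ρ ^ 2 * (stepRamp ((x - a) / ρ) * (-1 / ρ)) = -rampAt a ρ x := by
    rw [rampAt_apply]; field_simp
  rw [e] at h3
  exact h3

/-- Joint smoothness of `(a, x) ↦ step ((x - a)/ρ)`. [folklore] -/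
theorem contDiff_step_arg (ρ : ℝ) : ContDiff ℝ ∞ fun p : ℝ × ℝ => step ((p.2 - p.1) / ρ) :=
  step_contDiff.comp ((contDiff_snd.sub contDiff_fst).div_const ρ)

/-- The derivative of the step is smooth. [folklore] -/
theorem deriv_step_contDiff {n : ℕ∞} : ContDiff ℝ n (deriv step) := by
  have h := step_contDiff (n := n + 1)
  exact h.deriv'

/-- Joint smoothness of `(a, x) ↦ deriv step ((x - a)/ρ)`. [folklore] -/
theorem contDiff_deriv_step_arg (ρ : ℝ) : ContDiff ℝ ∞ fun p : ℝ × ℝ => deriv step ((p.2 - p.1) / ρ) :=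
  deriv_step_contDiff.comp ((contDiff_snd.sub contDiff_fst).div_const ρ)

/-- Joint smoothness of `(a, x) ↦ rampAt a ρ x`. [folklore] -/
theorem contDiff_rampAt_uncurry (ρ : ℝ) : ContDiff ℝ ∞ fun p : ℝ × ℝ => rampAt p.1 ρ p.2 := by
  unfold rampAt
  exact contDiff_const.mul (stepRamp_contDiff.comp ((contDiff_snd.sub contDiff_fst).div_const ρ))

/-- Joint smoothness of `(a, x) ↦ ramp2At a ρ x`. [folklore] -/
theorem contDiff_ramp2At_uncurry (ρ : ℝ) : ContDiff ℝ ∞ fun p : ℝ × ℝ => ramp2At p.1 ρ p.2 := by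
  unfold ramp2At
  exact contDiff_const.mul (stepRamp2_contDiff.comp ((contDiff_snd.sub contDiff_fst).div_const ρ))

/-! ## Rational clock-affine data -/

/-- **Clock-affine rational datum**: the values `v0` at clock value `α = 0` and `v1` at `α = 1`;
in between the quantity is `v0 + (v1 - v0) α`. [folklore] -/
structure Aff where
  /-- value at `α = 0` -/
  v0 : ℚ
  /-- value at `α = 1` -/
  v1 : ℚ
deriving DecidableEq, Inhabited

namespace Aff

/-- The real value at clock value `α`. [folklore] -/
def eval (a : Aff) (α : ℝ) : ℝ := (a.v0 : ℝ) + ((a.v1 : ℝ) - a.v0) * α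

/-- The rate `v1 - v0` (the `α`-derivative). [folklore] -/
def rate (a : Aff) : ℝ := (a.v1 : ℝ) - a.v0

/-- Unfolding. [folklore] -/
theorem eval_apply (a : Aff) (α : ℝ) : a.eval α = (a.v0 : ℝ) + ((a.v1 : ℝ) - a.v0) * α := rfl

/-- Unfolding. [folklore] -/
theorem rate_apply (a : Aff) : a.rate = (a.v1 : ℝ) - a.v0 := rfl

/-- Value at `α = 0`. [folklore] -/
@[simp] theorem eval_zero (a : Aff) : a.eval 0 = a.v0 := by rw [eval_apply]; ring

/-- Value at `α = 1`. [folklore] -/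
@[simp] theorem eval_one (a : Aff) : a.eval 1 = a.v1 := by rw [eval_apply]; ring

/-- The constant datum. [folklore] -/
def const (q : ℚ) : Aff := ⟨q, q⟩

/-- A constant datum evaluates to the constant. [folklore] -/
@[simp] theorem eval_const (q : ℚ) (α : ℝ) : (const q).eval α = q := by rw [const, eval_apply]; ring

/-- A constant datum has rate `0`. [folklore] -/
@[simp] theorem rate_const (q : ℚ) : (const q).rate = 0 := by rw [const, rate_apply]; ring

/-- Sum of data. [folklore] -/
def add (a b : Aff) : Aff := ⟨a.v0 + b.v0, a.v1 + b.v1⟩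

/-- Difference of data. [folklore] -/
def sub (a b : Aff) : Aff := ⟨a.v0 - b.v0, a.v1 - b.v1⟩

/-- Rational multiple of a datum. [folklore] -/
def smul (q : ℚ) (a : Aff) : Aff := ⟨q * a.v0, q * a.v1⟩

/-- Evaluation is additive. [folklore] -/
@[simp] theorem eval_add (a b : Aff) (α : ℝ) : (a.add b).eval α = a.eval α + b.eval α := by
  simp only [add, eval_apply]; push_cast; ring

/-- Evaluation of a difference. [folklore] -/
@[simp] theorem eval_sub (a b : Aff) (α : ℝ) : (a.sub b).eval α = a.eval α - b.eval α := by
  simp only [sub, eval_apply]; push_cast; ring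

/-- Evaluation of a multiple. [folklore] -/
@[simp] theorem eval_smul (q : ℚ) (a : Aff) (α : ℝ) : (smul q a).eval α = q * a.eval α := by
  simp only [smul, eval_apply]; push_cast; ring

/-- Rates are additive. [folklore] -/
@[simp] theorem rate_add (a b : Aff) : (a.add b).rate = a.rate + b.rate := by
  simp only [add, rate_apply]; push_cast; ring

/-- Rate of a difference. [folklore] -/
@[simp] theorem rate_sub (a b : Aff) : (a.sub b).rate = a.rate - b.rate := by
  simp only [sub, rate_apply]; push_cast; ring

/-- Rate of a multiple. [folklore] -/
@[simp] theorem rate_smul (q : ℚ) (a : Aff) : (smul q a).rate = q * a.rate := by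
  simp only [smul, rate_apply]; push_cast; ring

/-- **The `α`-derivative of the value is the rate.** [folklore] -/
theorem hasDerivAt_eval (a : Aff) (α : ℝ) : HasDerivAt a.eval a.rate α := by
  have h := ((hasDerivAt_id α).const_mul ((a.v1 : ℝ) - a.v0)).const_add (a.v0 : ℝ)
  simp only [mul_one] at h
  exact h.congr_of_eventuallyEq (Eventually.of_forall fun s => by simp [eval_apply])

/-- The value is smooth in `α`. [folklore] -/
theorem contDiff_eval (a : Aff) {n : WithTop ℕ∞} : ContDiff ℝ n a.eval := by
  have e : a.eval = fun α => (a.v0 : ℝ) + ((a.v1 : ℝ) - a.v0) * α := rfl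
  rw [e]; fun_prop

/-- The value is continuous in `α`. [folklore] -/
theorem continuous_eval (a : Aff) : Continuous a.eval := (a.contDiff_eval (n := 0)).continuous

/-- **Chain rule through a clock.** [folklore] -/
theorem hasDerivAt_eval_comp (a : Aff) {clk : ℝ → ℝ} {c t : ℝ} (h : HasDerivAt clk c t) :
    HasDerivAt (fun s => a.eval (clk s)) (c * a.rate) t := by
  have h' := (a.hasDerivAt_eval (clk t)).comp t h
  refine h'.congr_deriv ?_
  ring

/-- Boolean test `a ≤ b` at both endpoints. [folklore] -/
def leB (a b : Aff) : Bool := decide (a.v0 ≤ b.v0) && decide (a.v1 ≤ b.v1)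

/-- Boolean test `a < b` at both endpoints. [folklore] -/
def ltB (a b : Aff) : Bool := decide (a.v0 < b.v0) && decide (a.v1 < b.v1)

/-- **Order on `[0,1]` from the endpoints.** [folklore] -/
theorem eval_le_eval {a b : Aff} (h : leB a b = true) {α : ℝ} (hα : α ∈ Icc (0 : ℝ) 1) : a.eval α ≤ b.eval α := by
  simp only [leB, Bool.and_eq_true, decide_eq_true_eq] at h
  rw [eval_apply, eval_apply]
  exact affine_le_affine_of_endpoints (by exact_mod_cast h.1) (by exact_mod_cast h.2) hα

/-- **Strict order on `[0,1]` from the endpoints.** [folklore] -/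
theorem eval_lt_eval {a b : Aff} (h : ltB a b = true) {α : ℝ} (hα : α ∈ Icc (0 : ℝ) 1) : a.eval α < b.eval α := by
  simp only [ltB, Bool.and_eq_true, decide_eq_true_eq] at h
  rw [eval_apply, eval_apply]
  exact affine_lt_affine_of_endpoints (by exact_mod_cast h.1) (by exact_mod_cast h.2) hα

/-- A datum with both endpoints positive is positive on `[0,1]`. [folklore] -/
theorem eval_pos {a : Aff} (h : ltB (const 0) a = true) {α : ℝ} (hα : α ∈ Icc (0 : ℝ) 1) : 0 < a.eval α := by
  have h' := eval_lt_eval h hα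
  rwa [eval_const, Rat.cast_zero] at h'

/-- A datum with both endpoints nonnegative is nonnegative on `[0,1]`. [folklore] -/
theorem eval_nonneg {a : Aff} (h : leB (const 0) a = true) {α : ℝ} (hα : α ∈ Icc (0 : ℝ) 1) : 0 ≤ a.eval α := by
  have h' := eval_le_eval h hα
  rwa [eval_const, Rat.cast_zero] at h'

/-- The value on `[0,1]` lies between the endpoints (lower bound). [folklore] -/
theorem min_le_eval (a : Aff) {α : ℝ} (hα : α ∈ Icc (0 : ℝ) 1) : min (a.v0 : ℝ) a.v1 ≤ a.eval α :=
  min_le_affine hα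

/-- The value on `[0,1]` lies between the endpoints (upper bound). [folklore] -/
theorem eval_le_max (a : Aff) {α : ℝ} (hα : α ∈ Icc (0 : ℝ) 1) : a.eval α ≤ max (a.v0 : ℝ) a.v1 :=
  affine_le_max hα

end Aff

/-! ## Sums over lists: derivatives and smoothness -/

/-- Derivative of a sum over a list. [folklore] -/
theorem hasDerivAt_list_sum {ι : Type*} (L : List ι) {f : ι → ℝ → ℝ} {f' : ι → ℝ} {x : ℝ}
    (h : ∀ i ∈ L, HasDerivAt (f i) (f' i) x) :
    HasDerivAt (fun y => (L.map fun i => f i y).sum) (L.map f').sum x := by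
  induction L with
  | nil => simpa using hasDerivAt_const x (0 : ℝ)
  | cons a L ih =>
    simp only [List.map_cons, List.sum_cons]
    exact (h a (by simp)).add (ih fun i hi => h i (by simp [hi]))

/-- Smoothness of a sum over a list. [folklore] -/
theorem contDiff_list_sum {ι : Type*} {E : Type*} [NormedAddCommGroup E] [NormedSpace ℝ E] (L : List ι)
    {f : ι → E → ℝ} {n : WithTop ℕ∞} (h : ∀ i ∈ L, ContDiff ℝ n (f i)) :
    ContDiff ℝ n fun y => (L.map fun i => f i y).sum := by
  induction L with
  | nil => simpa using contDiff_const (c := (0 : ℝ))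
  | cons a L ih =>
    simp only [List.map_cons, List.sum_cons]
    exact (h a (by simp)).add (ih fun i hi => h i (by simp [hi]))

/-! ## Kinks -/

/-- **Kink data**: a breakpoint `b` and a slope jump `J`, both clock-affine, and a transition
length `ℓ`. The kink contributes `J(α) · rampAt (b(α)) ℓ u` to a profile. [folklore] -/
structure Kink where
  /-- breakpoint -/
  b : Aff
  /-- slope jump -/
  J : Aff
  /-- transition length -/
  ℓ : ℚ
deriving DecidableEq, Inhabited

namespace Kink

variable (k : Kink)

/-- The transition argument `(u - b(α))/ℓ`. [folklore] -/
def arg (α u : ℝ) : ℝ := (u - k.b.eval α) / k.ℓ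

/-- The value `J(α) · rampAt (b(α)) ℓ u`. [folklore] -/
def val (α u : ℝ) : ℝ := k.J.eval α * rampAt (k.b.eval α) k.ℓ u

/-- `∂ᵤ` of the value: `J(α) · step ((u - b(α))/ℓ)`. [folklore] -/
def du (α u : ℝ) : ℝ := k.J.eval α * step (k.arg α u)

/-- `∂_α` of the value: `J' · rampAt - J · b' · step`. [folklore] -/
def dα (α u : ℝ) : ℝ := k.J.rate * rampAt (k.b.eval α) k.ℓ u - k.J.eval α * k.b.rate * step (k.arg α u)

/-- `∂ᵤ∂ᵤ` of the value. [folklore] -/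
def duu (α u : ℝ) : ℝ := k.J.eval α * (deriv step (k.arg α u) / k.ℓ)

/-- `∂_α∂ᵤ` of the value. [folklore] -/
def dαu (α u : ℝ) : ℝ := k.J.rate * step (k.arg α u) - k.J.eval α * k.b.rate * (deriv step (k.arg α u) / k.ℓ)

/-- An antiderivative in `u` of `∂_α` of the value: `J' · ramp2At - J · b' · rampAt`. [folklore] -/
def dαPrim (α u : ℝ) : ℝ := k.J.rate * ramp2At (k.b.eval α) k.ℓ u - k.J.eval α * k.b.rate * rampAt (k.b.eval α) k.ℓ u

/-- Unfolding the argument. [folklore] -/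
theorem arg_apply (α u : ℝ) : k.arg α u = (u - k.b.eval α) / k.ℓ := rfl

/-- `∂ᵤ val = du`. [folklore] -/
theorem hasDerivAt_val_u (hℓ : (k.ℓ : ℝ) ≠ 0) (α u : ℝ) : HasDerivAt (k.val α) (k.du α u) u :=
  (hasDerivAt_rampAt hℓ u).const_mul _

/-- `∂ᵤ du = duu`. [folklore] -/
theorem hasDerivAt_du_u (α u : ℝ) : HasDerivAt (k.du α) (k.duu α u) u := by
  have h1 : HasDerivAt (fun y => (y - k.b.eval α) / k.ℓ) (1 / k.ℓ) u := by
    simpa using ((hasDerivAt_id u).sub_const (k.b.eval α)).div_const (k.ℓ : ℝ)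
  have h2 : HasDerivAt step (deriv step (k.arg α u)) ((u - k.b.eval α) / k.ℓ) :=
    (step_contDiff (n := 1)).differentiable one_ne_zero _ |>.hasDerivAt
  have h := (h2.comp u h1).const_mul (k.J.eval α)
  refine h.congr_deriv ?_
  simp only [duu]; ring

/-- `∂ᵤ dαPrim = dα`. [folklore] -/
theorem hasDerivAt_dαPrim_u (hℓ : (k.ℓ : ℝ) ≠ 0) (α u : ℝ) : HasDerivAt (k.dαPrim α) (k.dα α u) u :=
  ((hasDerivAt_ramp2At hℓ u).const_mul _).sub ((hasDerivAt_rampAt hℓ u).const_mul _)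

/-- `∂_α val = dα`. [folklore] -/
theorem hasDerivAt_val_α (hℓ : (k.ℓ : ℝ) ≠ 0) (α u : ℝ) : HasDerivAt (fun β => k.val β u) (k.dα α u) α := by
  have hJ := k.J.hasDerivAt_eval α
  have hb := k.b.hasDerivAt_eval α
  have hr : HasDerivAt (fun β => rampAt (k.b.eval β) k.ℓ u) (-step ((u - k.b.eval α) / k.ℓ) * k.b.rate) α :=
    (hasDerivAt_rampAt_breakpoint hℓ u (k.b.eval α)).comp α hb
  have h := hJ.mul hr
  refine h.congr_deriv ?_
  simp only [dα, arg]; ring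

/-- `∂_α du = dαu`. [folklore] -/
theorem hasDerivAt_du_α (α u : ℝ) : HasDerivAt (fun β => k.du β u) (k.dαu α u) α := by
  have hJ := k.J.hasDerivAt_eval α
  have hb := k.b.hasDerivAt_eval α
  have hs : HasDerivAt (fun β => step ((u - k.b.eval β) / k.ℓ)) (-(deriv step ((u - k.b.eval α) / k.ℓ) / k.ℓ) * k.b.rate) α :=
    (hasDerivAt_step_breakpoint k.ℓ u (k.b.eval α)).comp α hb
  have h := hJ.mul hs
  refine h.congr_deriv ?_
  simp only [dαu, arg]; ring

/-- Joint smoothness of the value in `(α, u)`. [folklore] -/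
theorem contDiff_val : ContDiff ℝ ∞ fun p : ℝ × ℝ => k.val p.1 p.2 := by
  unfold val
  exact ((k.J.contDiff_eval).comp contDiff_fst).mul
    ((contDiff_rampAt_uncurry k.ℓ).comp (((k.b.contDiff_eval).comp contDiff_fst).prodMk contDiff_snd))

/-- Joint smoothness of `du`. [folklore] -/
theorem contDiff_du : ContDiff ℝ ∞ fun p : ℝ × ℝ => k.du p.1 p.2 := by
  unfold du arg
  exact ((k.J.contDiff_eval).comp contDiff_fst).mul
    ((contDiff_step_arg k.ℓ).comp (((k.b.contDiff_eval).comp contDiff_fst).prodMk contDiff_snd))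

/-- Joint smoothness of `dα`. [folklore] -/
theorem contDiff_dα : ContDiff ℝ ∞ fun p : ℝ × ℝ => k.dα p.1 p.2 := by
  unfold dα arg
  refine (contDiff_const.mul ((contDiff_rampAt_uncurry k.ℓ).comp
    (((k.b.contDiff_eval).comp contDiff_fst).prodMk contDiff_snd))).sub ?_
  exact (((k.J.contDiff_eval).comp contDiff_fst).mul contDiff_const).mul
    ((contDiff_step_arg k.ℓ).comp (((k.b.contDiff_eval).comp contDiff_fst).prodMk contDiff_snd))

/-- Joint smoothness of `duu`. [folklore] -/
theorem contDiff_duu : ContDiff ℝ ∞ fun p : ℝ × ℝ => k.duu p.1 p.2 := by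
  unfold duu arg
  exact ((k.J.contDiff_eval).comp contDiff_fst).mul
    (((contDiff_deriv_step_arg k.ℓ).comp (((k.b.contDiff_eval).comp contDiff_fst).prodMk contDiff_snd)).div_const _)

/-- Joint smoothness of `dαu`. [folklore] -/
theorem contDiff_dαu : ContDiff ℝ ∞ fun p : ℝ × ℝ => k.dαu p.1 p.2 := by
  unfold dαu arg
  refine (contDiff_const.mul ((contDiff_step_arg k.ℓ).comp
    (((k.b.contDiff_eval).comp contDiff_fst).prodMk contDiff_snd))).sub ?_
  exact (((k.J.contDiff_eval).comp contDiff_fst).mul contDiff_const).mul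
    (((contDiff_deriv_step_arg k.ℓ).comp (((k.b.contDiff_eval).comp contDiff_fst).prodMk contDiff_snd)).div_const _)

/-- Joint smoothness of `dαPrim`. [folklore] -/
theorem contDiff_dαPrim : ContDiff ℝ ∞ fun p : ℝ × ℝ => k.dαPrim p.1 p.2 := by
  unfold dαPrim
  refine (contDiff_const.mul ((contDiff_ramp2At_uncurry k.ℓ).comp
    (((k.b.contDiff_eval).comp contDiff_fst).prodMk contDiff_snd))).sub ?_
  exact (((k.J.contDiff_eval).comp contDiff_fst).mul contDiff_const).mul
    ((contDiff_rampAt_uncurry k.ℓ).comp (((k.b.contDiff_eval).comp contDiff_fst).prodMk contDiff_snd))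

/-! ### Exact values below and above the transition -/

/-- Below the transition the value vanishes. [folklore] -/
theorem val_of_le (hℓ : 0 < (k.ℓ : ℝ)) {α u : ℝ} (hu : u ≤ k.b.eval α + k.ℓ / 3) : k.val α u = 0 := by
  rw [val, rampAt_of_le hℓ hu, mul_zero]

/-- Above the transition the value is exactly affine. [folklore] -/
theorem val_of_ge (hℓ : 0 < (k.ℓ : ℝ)) {α u : ℝ} (hu : k.b.eval α + 2 * k.ℓ / 3 ≤ u) :
    k.val α u = k.J.eval α * (u - k.b.eval α - k.ℓ / 2) := by
  rw [val, rampAt_of_ge hℓ hu]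

/-- Below the transition `du` vanishes. [folklore] -/
theorem du_of_le (hℓ : 0 < (k.ℓ : ℝ)) {α u : ℝ} (hu : u ≤ k.b.eval α + k.ℓ / 3) : k.du α u = 0 := by
  rw [du, arg, step_of_le, mul_zero]
  rw [div_le_iff₀ hℓ]; linarith

/-- Above the transition `du` is the full jump. [folklore] -/
theorem du_of_ge (hℓ : 0 < (k.ℓ : ℝ)) {α u : ℝ} (hu : k.b.eval α + 2 * k.ℓ / 3 ≤ u) : k.du α u = k.J.eval α := by
  rw [du, arg, step_of_ge, mul_one]
  rw [le_div_iff₀ hℓ]; linarith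

/-- `du` lies between `0` and the jump: it is `θ J` with `θ ∈ [0,1]`. [folklore] -/
theorem du_eq_smul (α u : ℝ) : ∃ θ ∈ Icc (0 : ℝ) 1, k.du α u = θ * k.J.eval α :=
  ⟨step (k.arg α u), step_mem_Icc _, by rw [du, mul_comm]⟩

/-- Below the transition `dα` vanishes. [folklore] -/
theorem dα_of_le (hℓ : 0 < (k.ℓ : ℝ)) {α u : ℝ} (hu : u ≤ k.b.eval α + k.ℓ / 3) : k.dα α u = 0 := by
  rw [dα, arg, rampAt_of_le hℓ hu, step_of_le, mul_zero, mul_zero, sub_zero]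
  rw [div_le_iff₀ hℓ]; linarith

/-- Above the transition `dα` is exactly affine. [folklore] -/
theorem dα_of_ge (hℓ : 0 < (k.ℓ : ℝ)) {α u : ℝ} (hu : k.b.eval α + 2 * k.ℓ / 3 ≤ u) :
    k.dα α u = k.J.rate * (u - k.b.eval α - k.ℓ / 2) - k.J.eval α * k.b.rate := by
  rw [dα, arg, rampAt_of_ge hℓ hu, step_of_ge, mul_one]
  rw [le_div_iff₀ hℓ]; linarith

/-- Below the transition `dαPrim` vanishes. [folklore] -/
theorem dαPrim_of_le (hℓ : 0 < (k.ℓ : ℝ)) {α u : ℝ} (hu : u ≤ k.b.eval α + k.ℓ / 3) : k.dαPrim α u = 0 := by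
  rw [dαPrim, ramp2At_of_le hℓ hu, rampAt_of_le hℓ hu, mul_zero, mul_zero, sub_zero]

/-- Above the transition `dαPrim` is exactly quadratic (with the universal constant `K₂`). [folklore] -/
theorem dαPrim_of_ge (hℓ : 0 < (k.ℓ : ℝ)) {α u : ℝ} (hu : k.b.eval α + 2 * k.ℓ / 3 ≤ u) :
    k.dαPrim α u = k.J.rate * ((u - k.b.eval α - k.ℓ / 2) ^ 2 / 2 + (k.ℓ : ℝ) ^ 2 * K₂) -
      k.J.eval α * k.b.rate * (u - k.b.eval α - k.ℓ / 2) := by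
  rw [dαPrim, ramp2At_of_ge hℓ hu, rampAt_of_ge hℓ hu]

end Kink

/-! ## Piecewise profiles -/

/-- **Piecewise profile data**: value offset `c`, base slope `s` (both clock-affine) and a list of
kinks; the profile is `F(α, u) = c(α) + s(α) u + Σ kinks`. [folklore] -/
structure Pw where
  /-- value offset -/
  c : Aff
  /-- base slope -/
  s : Aff
  /-- the kinks, in increasing order of breakpoints -/
  kinks : List Kink
deriving DecidableEq, Inhabited

namespace Pw

variable (F : Pw)

/-- **The value** `F(α, u)`. [folklore] -/
def val (α u : ℝ) : ℝ := F.c.eval α + F.s.eval α * u + (F.kinks.map fun k => k.val α u).sum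

/-- `∂ᵤ F`. [folklore] -/
def du (α u : ℝ) : ℝ := F.s.eval α + (F.kinks.map fun k => k.du α u).sum

/-- `∂_α F`. [folklore] -/
def dα (α u : ℝ) : ℝ := F.c.rate + F.s.rate * u + (F.kinks.map fun k => k.dα α u).sum

/-- `∂ᵤ∂ᵤ F`. [folklore] -/
def duu (α u : ℝ) : ℝ := (F.kinks.map fun k => k.duu α u).sum

/-- `∂_α∂ᵤ F`. [folklore] -/
def dαu (α u : ℝ) : ℝ := F.s.rate + (F.kinks.map fun k => k.dαu α u).sum

/-- An antiderivative in `u` of `∂_α F`. [folklore] -/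
def dαPrim (α u : ℝ) : ℝ := F.c.rate * u + F.s.rate * u ^ 2 / 2 + (F.kinks.map fun k => k.dαPrim α u).sum

/-- All transition lengths of the profile `G` are positive (a predicate on profiles, over `ℝ`).
[folklore] -/
def LenPos (G : Pw) : Prop := ∀ k ∈ G.kinks, 0 < (k.ℓ : ℝ)

/-- Boolean test: all transition lengths are positive. [folklore] -/
def lenPosB (G : Pw) : Bool := G.kinks.all fun k => decide (0 < k.ℓ)

/-- Soundness of the length test. [folklore] -/
theorem lenPos_of_lenPosB (h : F.lenPosB = true) : F.LenPos := by
  intro k hk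
  simp only [lenPosB, List.all_eq_true, decide_eq_true_eq] at h
  exact_mod_cast h k hk

variable {F}

/-- `∂ᵤ val = du`. [folklore] -/
theorem hasDerivAt_val_u (hF : F.LenPos) (α u : ℝ) : HasDerivAt (F.val α) (F.du α u) u := by
  have h1 : HasDerivAt (fun y => F.c.eval α + F.s.eval α * y) (F.s.eval α) u := by
    simpa using ((hasDerivAt_id u).const_mul (F.s.eval α)).const_add (F.c.eval α)
  have h2 := hasDerivAt_list_sum F.kinks (f := fun k y => k.val α y) (f' := fun k => k.du α u)
    fun k hk => k.hasDerivAt_val_u (hF k hk).ne' α u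
  exact h1.add h2

/-- `∂ᵤ du = duu`. [folklore] -/
theorem hasDerivAt_du_u (α u : ℝ) : HasDerivAt (F.du α) (F.duu α u) u := by
  have h2 := hasDerivAt_list_sum F.kinks (f := fun k y => k.du α y) (f' := fun k => k.duu α u)
    fun k _ => k.hasDerivAt_du_u α u
  have h := (hasDerivAt_const u (F.s.eval α)).add h2
  rw [zero_add] at h
  exact h

/-- `∂ᵤ dαPrim = dα`. [folklore] -/
theorem hasDerivAt_dαPrim_u (hF : F.LenPos) (α u : ℝ) : HasDerivAt (F.dαPrim α) (F.dα α u) u := by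
  have h1 : HasDerivAt (fun y => F.c.rate * y + F.s.rate * y ^ 2 / 2) (F.c.rate + F.s.rate * u) u := by
    have ha := (hasDerivAt_id u).const_mul F.c.rate
    have hb := ((hasDerivAt_pow 2 u).const_mul F.s.rate).div_const 2
    have h := ha.add hb
    refine h.congr_deriv ?_
    simp; ring
  have h2 := hasDerivAt_list_sum F.kinks (f := fun k y => k.dαPrim α y) (f' := fun k => k.dα α u)
    fun k hk => k.hasDerivAt_dαPrim_u (hF k hk).ne' α u
  exact h1.add h2

/-- `∂_α val = dα`. [folklore] -/
theorem hasDerivAt_val_α (hF : F.LenPos) (α u : ℝ) : HasDerivAt (fun β => F.val β u) (F.dα α u) α := by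
  have h1 : HasDerivAt (fun β => F.c.eval β + F.s.eval β * u) (F.c.rate + F.s.rate * u) α :=
    (F.c.hasDerivAt_eval α).add ((F.s.hasDerivAt_eval α).mul_const u)
  have h2 := hasDerivAt_list_sum F.kinks (f := fun k β => k.val β u) (f' := fun k => k.dα α u)
    fun k hk => k.hasDerivAt_val_α (hF k hk).ne' α u
  exact h1.add h2

/-- `∂_α du = dαu`. [folklore] -/
theorem hasDerivAt_du_α (α u : ℝ) : HasDerivAt (fun β => F.du β u) (F.dαu α u) α := by
  have h2 := hasDerivAt_list_sum F.kinks (f := fun k β => k.du β u) (f' := fun k => k.dαu α u)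
    fun k _ => k.hasDerivAt_du_α α u
  exact (F.s.hasDerivAt_eval α).add h2

/-- Joint smoothness of the value. [folklore] -/
theorem contDiff_val : ContDiff ℝ ∞ fun p : ℝ × ℝ => F.val p.1 p.2 := by
  unfold val
  refine (((F.c.contDiff_eval).comp contDiff_fst).add
    (((F.s.contDiff_eval).comp contDiff_fst).mul contDiff_snd)).add ?_
  exact contDiff_list_sum F.kinks fun k _ => k.contDiff_val

/-- Joint smoothness of `du`. [folklore] -/
theorem contDiff_du : ContDiff ℝ ∞ fun p : ℝ × ℝ => F.du p.1 p.2 := by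
  unfold du
  exact ((F.s.contDiff_eval).comp contDiff_fst).add (contDiff_list_sum F.kinks fun k _ => k.contDiff_du)

/-- Joint smoothness of `dα`. [folklore] -/
theorem contDiff_dα : ContDiff ℝ ∞ fun p : ℝ × ℝ => F.dα p.1 p.2 := by
  unfold dα
  exact (contDiff_const.add (contDiff_const.mul contDiff_snd)).add (contDiff_list_sum F.kinks fun k _ => k.contDiff_dα)

/-- Joint smoothness of `duu`. [folklore] -/
theorem contDiff_duu : ContDiff ℝ ∞ fun p : ℝ × ℝ => F.duu p.1 p.2 := by
  unfold duu
  exact contDiff_list_sum F.kinks fun k _ => k.contDiff_duu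

/-- Joint smoothness of `dαu`. [folklore] -/
theorem contDiff_dαu : ContDiff ℝ ∞ fun p : ℝ × ℝ => F.dαu p.1 p.2 := by
  unfold dαu
  exact contDiff_const.add (contDiff_list_sum F.kinks fun k _ => k.contDiff_dαu)

/-- Joint smoothness of `dαPrim`. [folklore] -/
theorem contDiff_dαPrim : ContDiff ℝ ∞ fun p : ℝ × ℝ => F.dαPrim p.1 p.2 := by
  unfold dαPrim
  refine ((contDiff_const.mul contDiff_snd).add ((contDiff_const.mul (contDiff_snd.pow 2)).div_const _)).add ?_
  exact contDiff_list_sum F.kinks fun k _ => k.contDiff_dαPrim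

/-! ### Exact closed forms on the gaps between transitions -/

/-- **Gap regime** `m` at `(α, u)`: the first `m` kinks are fully passed (`u ≥ bᵢ + 2ℓᵢ/3`) and
the remaining ones not yet begun (`u ≤ bᵢ + ℓᵢ/3`). [folklore] -/
def InGap (F : Pw) (m : ℕ) (α u : ℝ) : Prop :=
  (∀ k ∈ F.kinks.take m, k.b.eval α + 2 * k.ℓ / 3 ≤ u) ∧ (∀ k ∈ F.kinks.drop m, u ≤ k.b.eval α + k.ℓ / 3)

/-- **Gap slope** `W m = s + Σ_{i < m} Jᵢ`. [folklore] -/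
def W (F : Pw) (m : ℕ) (α : ℝ) : ℝ := F.s.eval α + ((F.kinks.take m).map fun k => k.J.eval α).sum

/-- **Gap value**: the exact affine form of the profile on gap `m`. [folklore] -/
def gapVal (F : Pw) (m : ℕ) (α u : ℝ) : ℝ :=
  F.c.eval α + F.s.eval α * u + ((F.kinks.take m).map fun k => k.J.eval α * (u - k.b.eval α - k.ℓ / 2)).sum

/-- **Gap `α`-derivative**: the exact form of `∂_α F` on gap `m`. [folklore] -/
def gapDα (F : Pw) (m : ℕ) (α u : ℝ) : ℝ :=
  F.c.rate + F.s.rate * u +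
    ((F.kinks.take m).map fun k => k.J.rate * (u - k.b.eval α - k.ℓ / 2) - k.J.eval α * k.b.rate).sum

/-- **Gap antiderivative**: the exact form of `dαPrim` on gap `m`. [folklore] -/
def gapDαPrim (F : Pw) (m : ℕ) (α u : ℝ) : ℝ :=
  F.c.rate * u + F.s.rate * u ^ 2 / 2 +
    ((F.kinks.take m).map fun k => k.J.rate * ((u - k.b.eval α - k.ℓ / 2) ^ 2 / 2 + (k.ℓ : ℝ) ^ 2 * K₂) -
      k.J.eval α * k.b.rate * (u - k.b.eval α - k.ℓ / 2)).sum

/-- A sum over the kinks splits at `m`, and the tail vanishes termwise. [folklore] -/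
theorem sum_kinks_eq_sum_take {f : Kink → ℝ} (m : ℕ) (h : ∀ k ∈ F.kinks.drop m, f k = 0) :
    (F.kinks.map f).sum = ((F.kinks.take m).map f).sum := by
  conv_lhs => rw [← List.take_append_drop m F.kinks]
  rw [List.map_append, List.sum_append]
  have h0 : ((F.kinks.drop m).map f).sum = 0 :=
    List.sum_eq_zero fun x hx => by
      obtain ⟨k, hk, rfl⟩ := List.mem_map.1 hx
      exact h k hk
  rw [h0, add_zero]

/-- **On gap `m` the value is the gap value.** [folklore] -/
theorem val_eq_gapVal (hF : F.LenPos) {m : ℕ} {α u : ℝ} (h : F.InGap m α u) : F.val α u = F.gapVal m α u := by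
  rw [val, gapVal, F.sum_kinks_eq_sum_take m fun k hk => k.val_of_le (hF k (List.mem_of_mem_drop hk)) (h.2 k hk)]
  congr 1
  refine congrArg List.sum (List.map_congr_left fun k hk => ?_)
  exact k.val_of_ge (hF k (List.mem_of_mem_take hk)) (h.1 k hk)

/-- **On gap `m` the slope is the gap slope.** [folklore] -/
theorem du_eq_W (hF : F.LenPos) {m : ℕ} {α u : ℝ} (h : F.InGap m α u) : F.du α u = F.W m α := by
  rw [du, W, F.sum_kinks_eq_sum_take m fun k hk => k.du_of_le (hF k (List.mem_of_mem_drop hk)) (h.2 k hk)]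
  congr 1
  refine congrArg List.sum (List.map_congr_left fun k hk => ?_)
  exact k.du_of_ge (hF k (List.mem_of_mem_take hk)) (h.1 k hk)

/-- **On gap `m` the `α`-derivative is the gap form.** [folklore] -/
theorem dα_eq_gapDα (hF : F.LenPos) {m : ℕ} {α u : ℝ} (h : F.InGap m α u) : F.dα α u = F.gapDα m α u := by
  rw [dα, gapDα, F.sum_kinks_eq_sum_take m fun k hk => k.dα_of_le (hF k (List.mem_of_mem_drop hk)) (h.2 k hk)]
  congr 1
  refine congrArg List.sum (List.map_congr_left fun k hk => ?_)
  exact k.dα_of_ge (hF k (List.mem_of_mem_take hk)) (h.1 k hk)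

/-- **On gap `m` the antiderivative is the gap form.** [folklore] -/
theorem dαPrim_eq_gapDαPrim (hF : F.LenPos) {m : ℕ} {α u : ℝ} (h : F.InGap m α u) :
    F.dαPrim α u = F.gapDαPrim m α u := by
  rw [dαPrim, gapDαPrim,
    F.sum_kinks_eq_sum_take m fun k hk => k.dαPrim_of_le (hF k (List.mem_of_mem_drop hk)) (h.2 k hk)]
  congr 1
  refine congrArg List.sum (List.map_congr_left fun k hk => ?_)
  exact k.dαPrim_of_ge (hF k (List.mem_of_mem_take hk)) (h.1 k hk)

/-! ### Bounds for the slope from the gap slopes (separated kinks) -/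

/-- **Separated kinks at clock value `α`**: consecutive transitions do not overlap,
`bᵢ + 2ℓᵢ/3 ≤ bᵢ₊₁ + ℓᵢ₊₁/3`. [folklore] -/
def KinksSep (L : List Kink) (α : ℝ) : Prop :=
  L.IsChain fun k k' => k.b.eval α + 2 * (k.ℓ : ℝ) / 3 ≤ k'.b.eval α + (k'.ℓ : ℝ) / 3

/-- The slope of the profile with kink list `L` (base slope `s₀`), as a function of the list.
[folklore] -/
private def duL (s₀ : ℝ) (L : List Kink) (α u : ℝ) : ℝ := s₀ + (L.map fun k => k.du α u).sum

/-- The gap slopes as a function of the list. [folklore] -/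
private def WL (s₀ : ℝ) (L : List Kink) (m : ℕ) (α : ℝ) : ℝ := s₀ + ((L.take m).map fun k => k.J.eval α).sum

/-- Appending a kink adds its slope contribution. [folklore] -/
private theorem duL_append (s₀ : ℝ) (L : List Kink) (k : Kink) (α u : ℝ) :
    duL s₀ (L ++ [k]) α u = duL s₀ L α u + k.du α u := by
  simp [duL, List.map_append, List.sum_append, add_assoc]

/-- Gap slopes of index `≤ |L|` do not see an appended kink. [folklore] -/
private theorem WL_append_of_le (s₀ : ℝ) (L : List Kink) (k : Kink) {m : ℕ} (hm : m ≤ L.length) (α : ℝ) :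
    WL s₀ (L ++ [k]) m α = WL s₀ L m α := by
  simp [WL, List.take_append_of_le_length hm]

/-- The last gap slope after appending a kink. [folklore] -/
private theorem WL_length_succ (s₀ : ℝ) (L : List Kink) (k : Kink) (α : ℝ) :
    WL s₀ (L ++ [k]) (L.length + 1) α = WL s₀ L L.length α + k.J.eval α := by
  simp [WL, List.take_length_add_append, List.map_append, List.sum_append, add_assoc]

/-- Separation passes to the initial segment. [folklore] -/
private theorem kinksSep_of_append {L : List Kink} {k : Kink} {α : ℝ} (h : KinksSep (L ++ [k]) α) : KinksSep L α :=
  (List.isChain_append.1 h).1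

/-- Separation between the last kink of `L` and an appended kink. [folklore] -/
private theorem last_le_of_append {L : List Kink} {k k₀ : Kink} {α : ℝ} (h : KinksSep (L ++ [k]) α)
    (hk₀ : k₀ ∈ L.getLast?) : k₀.b.eval α + 2 * k₀.ℓ / 3 ≤ k.b.eval α + k.ℓ / 3 :=
  (List.isChain_append.1 h).2.2 k₀ hk₀ k (by simp)

/-- Past the last transition the slope is the last gap slope (separated kinks). [folklore] -/
private theorem duL_eq_WL_length (s₀ α u : ℝ) :
    ∀ L : List Kink, (∀ k ∈ L, 0 < (k.ℓ : ℝ)) → KinksSep L α →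
      (∀ k₀ ∈ L.getLast?, k₀.b.eval α + 2 * k₀.ℓ / 3 ≤ u) → duL s₀ L α u = WL s₀ L L.length α := by
  intro L
  induction L using List.reverseRecOn with
  | nil => intro _ _ _; simp [duL, WL]
  | append_singleton L k ih =>
    intro hℓ hsep hu
    have hℓL : ∀ k' ∈ L, 0 < (k'.ℓ : ℝ) := fun k' hk' => hℓ k' (List.mem_append_left _ hk')
    have hℓk : 0 < (k.ℓ : ℝ) := hℓ k (by simp)
    have huk : k.b.eval α + 2 * k.ℓ / 3 ≤ u := hu k (by simp)
    have hL : duL s₀ L α u = WL s₀ L L.length α := by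
      refine ih hℓL (kinksSep_of_append hsep) fun k₀ hk₀ => ?_
      have h1 := last_le_of_append hsep hk₀
      linarith
    rw [duL_append, hL, k.du_of_ge hℓk huk, List.length_append, List.length_singleton, WL_length_succ]

/-- The slope lies between two bounds valid for all gap slopes (separated kinks, positive
lengths). [folklore] -/
private theorem duL_mem_Icc (s₀ lo hi α u : ℝ) :
    ∀ L : List Kink, (∀ k ∈ L, 0 < (k.ℓ : ℝ)) → KinksSep L α →
      (∀ m ≤ L.length, lo ≤ WL s₀ L m α ∧ WL s₀ L m α ≤ hi) → lo ≤ duL s₀ L α u ∧ duL s₀ L α u ≤ hi := by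
  intro L
  induction L using List.reverseRecOn with
  | nil =>
    intro _ _ hW
    have h0 := hW 0 le_rfl
    simp only [WL, List.take_nil, List.map_nil, List.sum_nil, add_zero] at h0
    simpa [duL] using h0
  | append_singleton L k ih =>
    intro hℓ hsep hW
    have hℓL : ∀ k' ∈ L, 0 < (k'.ℓ : ℝ) := fun k' hk' => hℓ k' (List.mem_append_left _ hk')
    have hℓk : 0 < (k.ℓ : ℝ) := hℓ k (by simp)
    have hWL : ∀ m ≤ L.length, lo ≤ WL s₀ L m α ∧ WL s₀ L m α ≤ hi := fun m hm => by
      have := hW m (by simp; omega)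
      rwa [WL_append_of_le s₀ L k hm] at this
    have ihb := ih hℓL (kinksSep_of_append hsep) hWL
    have hWlast : lo ≤ WL s₀ L L.length α + k.J.eval α ∧ WL s₀ L L.length α + k.J.eval α ≤ hi := by
      have := hW (L.length + 1) (by simp)
      rwa [WL_length_succ] at this
    rw [duL_append]
    rcases le_or_gt u (k.b.eval α + k.ℓ / 3) with hu | hu
    · rw [k.du_of_le hℓk hu, add_zero]; exact ihb
    · have hpast : duL s₀ L α u = WL s₀ L L.length α := by
        refine duL_eq_WL_length s₀ α u L hℓL (kinksSep_of_append hsep) fun k₀ hk₀ => ?_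
        have h1 := last_le_of_append hsep hk₀
        linarith
      rw [hpast]
      obtain ⟨θ, hθ, hdu⟩ := k.du_eq_smul α u
      rw [hdu]
      obtain ⟨hlo, hhi⟩ := hWL L.length le_rfl
      constructor <;> nlinarith [hθ.1, hθ.2, hWlast.1, hWlast.2]

/-- **The slope lies between bounds valid for all gap slopes** (separated kinks, positive
lengths): if `lo ≤ W m ≤ hi` for every `m ≤ #kinks`, then `lo ≤ ∂ᵤF(α, u) ≤ hi` for every `u`.
In particular positivity of a material map `Ξᵤ` is the finite check `0 < W m`. [folklore] -/
theorem du_mem_Icc_of_W (hF : F.LenPos) {α : ℝ} (hsep : KinksSep F.kinks α) {lo hi : ℝ}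
    (hW : ∀ m ≤ F.kinks.length, lo ≤ F.W m α ∧ F.W m α ≤ hi) (u : ℝ) : F.du α u ∈ Icc lo hi :=
  duL_mem_Icc (F.s.eval α) lo hi α u F.kinks hF hsep hW

/-- **Past the last transition the slope is the last gap slope.** [folklore] -/
theorem du_eq_W_length (hF : F.LenPos) {α : ℝ} (hsep : KinksSep F.kinks α) {u : ℝ}
    (hu : ∀ k₀ ∈ F.kinks.getLast?, k₀.b.eval α + 2 * k₀.ℓ / 3 ≤ u) : F.du α u = F.W F.kinks.length α :=
  duL_eq_WL_length (F.s.eval α) α u F.kinks hF hsep hu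

/-! ### Rational checks: separation and slope bounds on `[0,1]` from the endpoints -/

/-- The gap slope as rational affine data: `s + Σ_{i<m} Jᵢ`. [folklore] -/
def WAff (F : Pw) (m : ℕ) : Aff := ((F.kinks.take m).map Kink.J).foldr Aff.add F.s

/-- Evaluating a folded sum of data. [folklore] -/
theorem eval_foldr_add (L : List Aff) (a : Aff) (α : ℝ) :
    (L.foldr Aff.add a).eval α = a.eval α + (L.map fun b => b.eval α).sum := by
  induction L with
  | nil => simp
  | cons b L ih => simp [List.foldr_cons, ih]; ring

/-- The rational gap slope evaluates to the gap slope. [folklore] -/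
theorem eval_WAff (F : Pw) (m : ℕ) (α : ℝ) : (F.WAff m).eval α = F.W m α := by
  rw [WAff, eval_foldr_add, W, List.map_map]
  rfl

/-- Boolean test: all gap slopes lie in `[lo, hi]` at both endpoints. [folklore] -/
def slopesInB (F : Pw) (lo hi : ℚ) : Bool :=
  (List.range (F.kinks.length + 1)).all fun m =>
    Aff.leB (Aff.const lo) (F.WAff m) && Aff.leB (F.WAff m) (Aff.const hi)

/-- Soundness of the slope test. [folklore] -/
theorem W_mem_of_slopesInB {lo hi : ℚ} (h : F.slopesInB lo hi = true) {α : ℝ} (hα : α ∈ Icc (0 : ℝ) 1) :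
    ∀ m ≤ F.kinks.length, (lo : ℝ) ≤ F.W m α ∧ F.W m α ≤ hi := by
  intro m hm
  simp only [slopesInB, List.all_eq_true, List.mem_range, Bool.and_eq_true] at h
  obtain ⟨h1, h2⟩ := h m (by omega)
  have e1 := Aff.eval_le_eval h1 hα
  have e2 := Aff.eval_le_eval h2 hα
  rw [Aff.eval_const, eval_WAff] at e1
  rw [eval_WAff, Aff.eval_const] at e2
  exact ⟨e1, e2⟩

end Pw

namespace Kink

/-- The edge `b + c ℓ` of a kink as rational affine data. [folklore] -/
def edge (k : Kink) (c : ℚ) : Aff := k.b.add (Aff.const (c * k.ℓ))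

/-- Evaluating an edge. [folklore] -/
theorem eval_edge (k : Kink) (c : ℚ) (α : ℝ) : (k.edge c).eval α = k.b.eval α + c * k.ℓ := by
  rw [edge, Aff.eval_add, Aff.eval_const]; push_cast; ring

end Kink

/-- Boolean test: consecutive transitions are separated at both endpoints. [folklore] -/
def kinksSepB : List Kink → Bool
  | [] => true
  | [_] => true
  | k :: k' :: L => Aff.leB (k.edge (2 / 3)) (k'.edge (1 / 3)) && kinksSepB (k' :: L)

/-- **Soundness of the separation test**: separated at the endpoints means separated for every
clock value in `[0,1]` (all edges are affine in `α`). [folklore] -/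
theorem kinksSep_of_kinksSepB : ∀ {L : List Kink}, kinksSepB L = true → ∀ {α : ℝ}, α ∈ Icc (0 : ℝ) 1 → Pw.KinksSep L α
  | [], _, _, _ => List.isChain_nil
  | [_], _, _, _ => List.isChain_singleton _
  | k :: k' :: L, h, α, hα => by
    simp only [kinksSepB, Bool.and_eq_true] at h
    have htail := kinksSep_of_kinksSepB h.2 hα
    refine List.isChain_cons_cons.2 ⟨?_, htail⟩
    have e := Aff.eval_le_eval h.1 hα
    rw [Kink.eval_edge, Kink.eval_edge] at e
    push_cast at e
    linarith

namespace Pw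

/-- **All checks at once**: positive lengths, separated kinks and gap slopes in `[lo, hi]` give
`∂ᵤF(α, u) ∈ [lo, hi]` for every clock value `α ∈ [0,1]` and every `u`. [folklore] -/
theorem du_mem_Icc_of_checks {F : Pw} {lo hi : ℚ} (h1 : F.lenPosB = true) (h2 : kinksSepB F.kinks = true)
    (h3 : F.slopesInB lo hi = true) {α : ℝ} (hα : α ∈ Icc (0 : ℝ) 1) (u : ℝ) :
    F.du α u ∈ Icc (lo : ℝ) hi :=
  du_mem_Icc_of_W (F.lenPos_of_lenPosB h1) (kinksSep_of_kinksSepB h2 hα) (F.W_mem_of_slopesInB h3 hα) u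

end Pw

end PlanarKinematics

end Literature.Analysis.FluidPDE
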